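import Summits.QuantumFields.YangMills.Theorems.SwapVirialDeficitSectorLaplaceTipHalves
import Summits.QuantumFields.YangMills.Theorems.SwapVirialDeficitBlowUpGnomonicHubCentre
import HarnessLib

/-!
# THE TIP OF SKELETON ➎: `stub_core_tip` FROM THE POSITIVE HALF-WINDOW BOUND ALONE (centre symmetry of the seam)
# (cell ym-idea-1; free-hands support of ⟨stmt-QuantumFields-24197⟩ `SwapVirialDeficit.SwapGluedStiffness`; w3 g68 ✓`hubIntegral_hubAt_neg` (the apex `c → −1`
# is the apex `c → +1` seen through the centre of `SU(2)`), g49 ✓`tipBound_of_halves`)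

* `tipHalf_neg_eq_pos` — `∫_{(1+δ²)⁻¹<τ ∧ δ<0} ((1+δ²)⁻¹)²·I(hubAt δ 1) dδ = ∫_{(1+δ²)⁻¹<τ ∧ 0<δ} ((1+δ²)⁻¹)²·I(hubAt δ 1) dδ` (✓`BlowUpRing.setIntegral_eq_of_neg`,
  ✓`BlowUpRing.hubIntegral_hubAt_neg`);
* ★★★ `tipBound_of_pos (hpos) : hT` and ★★★ `stub_core_tip_of_pos (hpos) : <stub_core_tip of ➎ v14 VERBATIM>` — the negative socket of ✓`tipBound_of_halves` is the
  positive one read through the reflection `δ ↦ −δ`.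
So the tip needs ONE bound: the positive half-window socket of ✓`…TipHalves` (two-rate + `e^{−√b}` tail).

HONEST LABEL: bookkeeping; the positive half bound, `stub_core_tip`, ⟨24197⟩ ∕ ⟨24194⟩ are OPEN; item of record ⟨24085⟩ `SubOctaveBounded` aside ∕ untouched; the
Yang–Mills mass gap is NOT proved; no summit is proved by a line.  THEOREMS ONLY (0 `def`, 0 `sorry`), standard axioms, no instances.  Seat ym-line-fcl-p3 g49
(cell ym-idea-1, free hands = ➎ assembler), `--supports stmt-QuantumFields-24197`.  References: [cite: Luscher1983, §2]; [folklore].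
-/

set_option autoImplicit false
set_option synthInstance.maxSize 1024

noncomputable section

open MeasureTheory Quaternion Set Module
open scoped Quaternion BigOperators ENNReal
open Literature.MathematicalPhysics.QuantumLattice
open Literature.MathematicalPhysics.QuantumFieldTheory hiding SU2
open Summit.QuantumFields.YangMills.Theorems.SwapTwistDeficit.ToronLog

namespace Summit.QuantumFields.YangMills.Theorems.SwapVirialDeficit.SectorLaplace

open Summit.QuantumFields.YangMills.Theorems.FemtoTransferGap
open Summit.QuantumFields.YangMills.Theorems.FemtoTransferGap.TT
open Summit.QuantumFields.YangMills.Theorems.VirialFluxGap.RingDeficit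
open Summit.QuantumFields.YangMills.Theorems.SwapVirialDeficit.SwapRing
open Summit.QuantumFields.YangMills.Theorems.SwapVirialDeficit.BlowUpRing

variable {L : ℕ} [NeZero L]

/-- ★ **THE NEGATIVE HALF-WINDOW IS THE POSITIVE ONE** (reflection `δ ↦ −δ`; the integrand is even by the centre symmetry ✓`hubIntegral_hubAt_neg`). [folklore] -/
theorem tipHalf_neg_eq_pos (ε : GnoSign L) (τ b : ℝ) :
    ∫ δ in {δ : ℝ | (1 + δ ^ 2)⁻¹ < τ ∧ δ < 0}, ((1 + δ ^ 2)⁻¹) ^ 2 * hubIntegral (L := L) (hubAt δ 1) ε b =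
      ∫ δ in {δ : ℝ | (1 + δ ^ 2)⁻¹ < τ ∧ 0 < δ}, ((1 + δ ^ 2)⁻¹) ^ 2 * hubIntegral (L := L) (hubAt δ 1) ε b := by
  obtain ⟨hP, hN, -⟩ := tipWindow_halves_measurable_disjoint τ
  refine setIntegral_eq_of_neg (f := fun δ => ((1 + δ ^ 2)⁻¹) ^ 2 * hubIntegral (L := L) (hubAt δ 1) ε b) (fun x => ?_) hN hP (fun x => ?_)
  · simp only [neg_sq, hubIntegral_hubAt_neg]
  · simp only [mem_setOf_eq, neg_sq, neg_lt_zero]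

/-- ★★★ **`hT` OF ✓`stub_core_tip_of_tipBound` FROM THE POSITIVE HALF-WINDOW BOUND ALONE** (✓`tipBound_of_halves` with the negative socket obtained by reflection). [cite: Luscher1983, §2] -/
theorem tipBound_of_pos
    (hpos : ∃ C : ℝ, 0 < C ∧ ∃ c : ℕ, ∃ γ : ℝ, 0 < γ ∧ ∃ D : ℝ, 0 ≤ D ∧ ∃ d d' : ℕ, ∃ η : ℝ, 0 < η ∧
      ∃ CT : ℝ, ∃ pT : ℕ, ∃ QT : ℝ, 0 < QT ∧ ∃ qT : ℕ, ∃ K₁ : ℝ, 0 < K₁ ∧ ∃ k₁ : ℕ, ∃ τw : ℝ, 0 < τw ∧ ∃ kw : ℕ,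
      ∀ (L : ℕ) [NeZero L] (τ : ℝ), 0 < τ → τ ≤ τw / (L : ℝ) ^ kw → ∀ b : ℝ, K₁ * (L : ℝ) ^ k₁ * τ⁻¹ ^ k₁ ≤ b → ∀ ε : GnoSign L, GoodSign ε →
        stiffKappa L (1 / 8) * (coneConst * Real.pi *
          ∫ δ in {δ : ℝ | (1 + δ ^ 2)⁻¹ < τ ∧ 0 < δ}, ((1 + δ ^ 2)⁻¹) ^ 2 * hubIntegral (L := L) (hubAt δ 1) ε b) ≤
          (C * (L : ℝ) ^ c * τ ^ γ + D * (L : ℝ) ^ d * τ⁻¹ ^ d' * b ^ (-η)) *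
              ((2 * Real.pi / b) ^ alpha L * ∫ a in HubBulk τ, (∫ p : ℝ × ℝ, mbDensity (L := L) a ε p) ∂coneMeasure) +
            Real.exp (CT * (L : ℝ) ^ pT - Real.sqrt b * τ ^ qT / (QT * (L : ℝ) ^ pT))) :
    ∃ K : ℝ, 0 < K ∧ ∃ k : ℕ, ∃ τ₀ : ℝ, 0 < τ₀ ∧ τ₀ ≤ 1 / 2 ∧ ∀ (L : ℕ) [NeZero L] (τ : ℝ), 0 < τ → τ ≤ τ₀ / (L : ℝ) ^ k →
      ∀ b : ℝ, K * (L : ℝ) ^ k * τ⁻¹ ^ k ≤ b → ∀ ε : GnoSign L, GoodSign ε →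
        stiffKappa L (1 / 8) * (coneConst * Real.pi *
          ∫ p in {p : ℝ × GnoCoord L | (1 + p.1 ^ 2)⁻¹ < τ},
              Real.exp (-(b * gnoDeficit z₀ (fun _ => 1) (hubAt p.1 1) ε p.2))
              ∂((volume : Measure (ℝ × GnoCoord L)).withDensity fun p => ENNReal.ofReal (((1 + p.1 ^ 2)⁻¹) ^ 2 * gnoDensity p.2))) ≤
          (1 / 64 : ℝ) * ((2 * Real.pi / b) ^ alpha L * ∫ a in HubBulk τ, (∫ p : ℝ × ℝ, mbDensity a ε p) ∂coneMeasure) := by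
  refine tipBound_of_halves hpos ?_
  obtain ⟨C, hC, c, γ, hγ, D, hD, d, d', η, hη, CT, pT, QT, hQT, qT, K₁, hK₁, k₁, τw, hτw, kw, H⟩ := hpos
  refine ⟨C, hC, c, γ, hγ, D, hD, d, d', η, hη, CT, pT, QT, hQT, qT, K₁, hK₁, k₁, τw, hτw, kw, fun L _ τ hτ hτle b hb ε hε => ?_⟩
  rw [tipHalf_neg_eq_pos ε τ b]
  exact H L τ hτ hτle b hb ε hε

/-- ★★★ **`stub_core_tip` OF SKELETON ➎ v14 VERBATIM FROM THE POSITIVE HALF-WINDOW BOUND ALONE** (✓`stub_core_tip_of_tipBound` ∘ ✓`tipBound_of_pos`). [cite: Luscher1983, §2] -/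
theorem stub_core_tip_of_pos
    (hpos : ∃ C : ℝ, 0 < C ∧ ∃ c : ℕ, ∃ γ : ℝ, 0 < γ ∧ ∃ D : ℝ, 0 ≤ D ∧ ∃ d d' : ℕ, ∃ η : ℝ, 0 < η ∧
      ∃ CT : ℝ, ∃ pT : ℕ, ∃ QT : ℝ, 0 < QT ∧ ∃ qT : ℕ, ∃ K₁ : ℝ, 0 < K₁ ∧ ∃ k₁ : ℕ, ∃ τw : ℝ, 0 < τw ∧ ∃ kw : ℕ,
      ∀ (L : ℕ) [NeZero L] (τ : ℝ), 0 < τ → τ ≤ τw / (L : ℝ) ^ kw → ∀ b : ℝ, K₁ * (L : ℝ) ^ k₁ * τ⁻¹ ^ k₁ ≤ b → ∀ ε : GnoSign L, GoodSign ε →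
        stiffKappa L (1 / 8) * (coneConst * Real.pi *
          ∫ δ in {δ : ℝ | (1 + δ ^ 2)⁻¹ < τ ∧ 0 < δ}, ((1 + δ ^ 2)⁻¹) ^ 2 * hubIntegral (L := L) (hubAt δ 1) ε b) ≤
          (C * (L : ℝ) ^ c * τ ^ γ + D * (L : ℝ) ^ d * τ⁻¹ ^ d' * b ^ (-η)) *
              ((2 * Real.pi / b) ^ alpha L * ∫ a in HubBulk τ, (∫ p : ℝ × ℝ, mbDensity (L := L) a ε p) ∂coneMeasure) +
            Real.exp (CT * (L : ℝ) ^ pT - Real.sqrt b * τ ^ qT / (QT * (L : ℝ) ^ pT))) :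
    ∃ K : ℝ, 0 < K ∧ ∃ k : ℕ, ∃ τ₀ : ℝ, 0 < τ₀ ∧ τ₀ ≤ 1 / 2 ∧ ∀ (L : ℕ) [NeZero L] (τ : ℝ), 0 < τ → τ ≤ τ₀ / (L : ℝ) ^ k →
      ∀ b : ℝ, K * (L : ℝ) ^ k * τ⁻¹ ^ k ≤ b →
        stiffKappa L (1 / 8) * ∑ ε ∈ (Finset.univ.filter fun ε : GnoSign L => GoodSign ε),
            ∫ x in TipHub τ ×ˢ (univ : Set (GnoCoord L)), Real.exp (-(b * gnoDeficit z₀ (fun _ => 1) x.1 ε x.2)) ∂chartMeasure L ≤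
          (1 / 32 : ℝ) * ∑ ε ∈ (Finset.univ.filter fun ε : GnoSign L => GoodSign ε), ∫ a in HubBulk τ, hubIntegral a ε b ∂coneMeasure :=
  stub_core_tip_of_tipBound (tipBound_of_pos hpos)

end Summit.QuantumFields.YangMills.Theorems.SwapVirialDeficit.SectorLaplace

end
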